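import Literature.NumberTheory.GaloisRepresentations.GaloisRep
import HarnessLib

/-!
# Places at which a Galois representation is Steinberg-shaped up to semisimplification

Topic `Literature/NumberTheory/GaloisRepresentations`.  Let `K` be a number field,
`r : Γ_K →ₜ* GL_n(A)` a framed Galois representation (`FramedGaloisRep K A n`) and `w` a finite place
of `K` with residue cardinality `q_w = N w` (`w.residueCard`).  The **locally-Steinberg hypothesis**
of the residually reducible automorphy lifting theorems of Thorne and Allen–Newton–Thorne
[AllenNewtonThorne2020, Thm 1.1 (v)] reads

  `r|_{G_{K_w}}^{ss} ≅ ⊕_{i=1}^{n} ψ ε^{n-i}` for some UNRAMIFIED character `ψ : G_{K_w} → A×`,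

`ε` the cyclotomic character (so `ε(Frob_w) = q_w` for an ARITHMETIC Frobenius, the tree's
convention, `GaloisRep.HasFrobCharpolyAt`).  It is a condition on the semisimplification only: it
is satisfied by an unramified twist of the Steinberg representation (maximal unipotent monodromy)
as well as by its degenerations, down to the unramified representation whose Frobenius eigenvalues
are `ψ(Frob) q_w^{j}`, `0 ≤ j < n` (the "level-raising" shape).

`FramedGaloisRep.IsSteinbergShapedSSAt w r` states it in the tree's GLOBAL vocabulary (no local
field, no restriction map, no cyclotomic character at `w` needed; compare
`FramedGaloisRep.IsUnramifiedAt`, `HasFrobCharpolyAt`): at every prime `𝔓 ∣ w` of `ℤ̄_K`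
(`w.primesAbove`) there are a frame `P ∈ GL_n(A)` and a bijection `e : Fin n ≃ Fin n` such that
`P r(τ) P⁻¹` is upper triangular for `τ` in the decomposition group `D_𝔓`
(`Ideal.decompositionSubgroup`), has diagonal entries `1` for `τ` in the inertia group `I_𝔓`
(`Ideal.inertia`; the diagonal characters are unramified), and has diagonal
`(c · q_w^{e 0}, …, c · q_w^{e (n-1)})` for every arithmetic Frobenius `τ` at `𝔓` (Mathlib
`IsArithFrobAt`) and some scalar `c` — i.e. the diagonal characters are `ψ ε^{e i}` with
`ψ(Frob) = c`.  (A representation of `D_𝔓` whose semisimplification is a sum of characters admits a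
full invariant flag, so asking for a triangular frame loses nothing; the permutation `e` records that
the order of the characters along the flag is not prescribed.)

Not defined here: the stronger "genuinely Steinberg" condition (monodromy of rank `n - 1`), and the
automorphic-side hypothesis "`π_w` is an unramified twist of the Steinberg representation"
[AllenNewtonThorne2020, Thm 1.1 (vi)(c)] (the tree extracts no local component `π_w`).

## References
* [AllenNewtonThorne2020] P. Allen, J. Newton, J. Thorne, *Automorphy lifting for residually
  reducible l-adic Galois representations, II*, Compositio Math. 156 (2020), Thm 1.1, hypothesis (v)
  (arXiv:1912.11269, p. 2).
* [Thorne2014] J. Thorne, *Automorphy lifting for residually reducible l-adic Galois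
  representations*, J. Amer. Math. Soc. 28 (2015), Thm 1.1 / §1 (the Steinberg place `v₀`).
-/

noncomputable section

namespace Literature.NumberTheory.GaloisRepresentations

open Field IsDedekindDomain
open scoped NumberField

universe u v

variable {K : Type u} [Field K] {A : Type v} [CommRing A] [TopologicalSpace A] {n : ℕ}

/-- **`r : Γ_K →ₜ* GL_n(A)` is Steinberg-shaped up to semisimplification at the finite place `w`**
(`r|^{ss}_{G_{K_w}} ≅ ⊕_{i=1}^{n} ψ ε^{n-i}`, `ψ` unramified — the locally-Steinberg hypothesis (v) of
Allen–Newton–Thorne): at every `𝔓 ∣ w` there are a frame `P` and a bijection `e` of `Fin n` with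
`P r(τ) P⁻¹` upper triangular on the decomposition group `D_𝔓`, with diagonal entries `1` on the
inertia group `I_𝔓`, and with diagonal `i ↦ c · (N w)^{e i}` (one scalar `c`) at every arithmetic
Frobenius `τ` at `𝔓`. [cite: AllenNewtonThorne2020, Thm 1.1 (v)] -/
def FramedGaloisRep.IsSteinbergShapedSSAt [NumberField K] (w : HeightOneSpectrum (𝓞 K))
    (r : FramedGaloisRep K A n) : Prop :=
  ∀ 𝔓 ∈ w.primesAbove, ∃ (P : GL (Fin n) A) (e : Fin n ≃ Fin n),
    (∀ τ ∈ 𝔓.decompositionSubgroup (absoluteGaloisGroup K), ∀ i j : Fin n, j < i →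
        ((P * r τ * P⁻¹ : GL (Fin n) A) : Matrix (Fin n) (Fin n) A) i j = 0) ∧
    (∀ τ ∈ 𝔓.inertia (absoluteGaloisGroup K), ∀ i : Fin n,
        ((P * r τ * P⁻¹ : GL (Fin n) A) : Matrix (Fin n) (Fin n) A) i i = 1) ∧
    (∀ τ : absoluteGaloisGroup K, IsArithFrobAt (𝓞 K) τ 𝔓 → ∃ c : A, ∀ i : Fin n,
        ((P * r τ * P⁻¹ : GL (Fin n) A) : Matrix (Fin n) (Fin n) A) i i =
          c * (w.residueCard : A) ^ ((e i : Fin n) : ℕ))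

/-- Unfolding lemma for `IsSteinbergShapedSSAt`. [cite: AllenNewtonThorne2020, Thm 1.1 (v)] -/
theorem FramedGaloisRep.isSteinbergShapedSSAt_iff [NumberField K] (w : HeightOneSpectrum (𝓞 K))
    (r : FramedGaloisRep K A n) :
    r.IsSteinbergShapedSSAt w ↔
      ∀ 𝔓 ∈ w.primesAbove, ∃ (P : GL (Fin n) A) (e : Fin n ≃ Fin n),
        (∀ τ ∈ 𝔓.decompositionSubgroup (absoluteGaloisGroup K), ∀ i j : Fin n, j < i →
            ((P * r τ * P⁻¹ : GL (Fin n) A) : Matrix (Fin n) (Fin n) A) i j = 0) ∧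
        (∀ τ ∈ 𝔓.inertia (absoluteGaloisGroup K), ∀ i : Fin n,
            ((P * r τ * P⁻¹ : GL (Fin n) A) : Matrix (Fin n) (Fin n) A) i i = 1) ∧
        (∀ τ : absoluteGaloisGroup K, IsArithFrobAt (𝓞 K) τ 𝔓 → ∃ c : A, ∀ i : Fin n,
            ((P * r τ * P⁻¹ : GL (Fin n) A) : Matrix (Fin n) (Fin n) A) i i =
              c * (w.residueCard : A) ^ ((e i : Fin n) : ℕ)) :=
  Iff.rfl

/-- **Independence of the frame**: `IsSteinbergShapedSSAt` is invariant under conjugation of `r` by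
`Q ∈ GL_n(A)` (replace the frame `P` by `P Q⁻¹`). [folklore] -/
theorem FramedGaloisRep.isSteinbergShapedSSAt_conj_iff [NumberField K] [IsTopologicalRing A]
    (w : HeightOneSpectrum (𝓞 K)) (Q : GL (Fin n) A) (r : FramedGaloisRep K A n) :
    FramedGaloisRep.IsSteinbergShapedSSAt w (FramedRep.conj Q r) ↔ r.IsSteinbergShapedSSAt w := by
  have key : ∀ (P : GL (Fin n) A) (τ : absoluteGaloisGroup K),
      P * (FramedRep.conj Q r) τ * P⁻¹ = (P * Q) * r τ * (P * Q)⁻¹ := fun P τ => by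
    rw [FramedRep.conj_apply]; group
  constructor
  · intro h 𝔓 h𝔓
    obtain ⟨P, e, h1, h2, h3⟩ := h 𝔓 h𝔓
    refine ⟨P * Q, e, fun τ hτ i j hij => ?_, fun τ hτ i => ?_, fun τ hτ => ?_⟩
    · rw [← key]; exact h1 τ hτ i j hij
    · rw [← key]; exact h2 τ hτ i
    · obtain ⟨c, hc⟩ := h3 τ hτ
      exact ⟨c, fun i => by rw [← key]; exact hc i⟩
  · intro h 𝔓 h𝔓
    obtain ⟨P, e, h1, h2, h3⟩ := h 𝔓 h𝔓
    have key' : ∀ τ : absoluteGaloisGroup K,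
        (P * Q⁻¹) * (FramedRep.conj Q r) τ * (P * Q⁻¹)⁻¹ = P * r τ * P⁻¹ := fun τ => by
      rw [FramedRep.conj_apply]; group
    refine ⟨P * Q⁻¹, e, fun τ hτ i j hij => ?_, fun τ hτ i => ?_, fun τ hτ => ?_⟩
    · rw [key']; exact h1 τ hτ i j hij
    · rw [key']; exact h2 τ hτ i
    · obtain ⟨c, hc⟩ := h3 τ hτ
      exact ⟨c, fun i => by rw [key']; exact hc i⟩

/-- **Non-vacuity in rank one**: the trivial representation `1 : Γ_K →ₜ* GL_1(A)` is
Steinberg-shaped up to semisimplification at every finite place (frame `1`, `e = id`, `c = 1`).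
[folklore] -/
theorem FramedGaloisRep.isSteinbergShapedSSAt_one [NumberField K] (w : HeightOneSpectrum (𝓞 K)) :
    FramedGaloisRep.IsSteinbergShapedSSAt w (1 : FramedGaloisRep K A 1) := by
  intro 𝔓 _
  refine ⟨1, Equiv.refl _, fun τ _ i j hij => ?_, fun τ _ i => ?_, fun τ _ => ⟨1, fun i => ?_⟩⟩
  · exact absurd hij (by omega)
  · simp [Subsingleton.elim i 0]
  · simp [Subsingleton.elim i 0]

end Literature.NumberTheory.GaloisRepresentations
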